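import Summits.QuantumAdvantage.QuantumAdvantage.Theorems.CubicForrelationNearExactIsExactAmmCeilingX
import Literature.Computability.QuantumComplexity.ForrelationDirectSum

/-!
# Crux `CubicForrelation.NearExactIsExact` (stmt-QuantumAdvantage-14043) — almost-MM ceiling, part M:
a PERIODIC `φ` yields an M-subspace

Line `direct-sum-amplification`, lead c3 (helper file for the registered stub `stub_ammCeiling`).
Setting: `g` on `a + (a+2)` bits in almost-Maiorana–McFarland sign form
`(−1)^{g(y₁‖y₂)} = (−1)^{y₁·φ(y₂)} (−1)^{h(y₂)}`.  If `φ` is `w`-periodic for a non-zero `w ∈ 𝔽₂^{a+2}`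
(type (a) of the rank-two pencil in the lead's endgame), then
`V := {y₁ ‖ (t·w) : y₁ ∈ 𝔽₂^a, t ∈ 𝔽₂}` is a linear subspace of dimension `a + 1` containing `0`, with
`|V|² = 2^{a+(a+2)}`, and every second difference of `g` along `V` vanishes: the first difference of `g` in a
direction `b₁ ‖ (t·w)` at `y₁ ‖ y₂` is `b₁·φ(y₂) ⊕ y₁·(φ(y₂) ⊕ φ(y₂ ⊕ t·w)) ⊕ (h(y₂) ⊕ h(y₂ ⊕ t·w))`, and
periodicity kills the middle term, leaving an affine function of `(y₁, t)`-cosets.  This is the unfolded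
`HasMSubspace g` of the skeleton (Kudin–Pasalic–Polujan–Zhang, arXiv:2508.14265, Prop. 4.1: the `y₁`-block
extended by `⟨0 ‖ w⟩`).

References: C. Carlet, *Boolean Functions for Cryptography and Coding Theory* (CUP 2021), §5.1, §6.1
(Maiorana–McFarland class and its second-derivative characterisation, Dillon).
-/

set_option linter.dupNamespace false -- D-0017: single-problem summit ⇒ `QuantumAdvantage.QuantumAdvantage` by design

noncomputable section

namespace Summit.QuantumAdvantage.QuantumAdvantage.Theorems.CubicForrelation.NearExactIsExact

open Finset
open Literature.Computability.QuantumComplexity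
open Literature.Computability.QuantumComplexity.BuzetChailloux (bxor zeroVec signOf_sq bxor_zeroVec zeroVec_bxor
  bxor_comm bxor_self bxor_bxor_cancel_left twist_zeroVec_right twist_bxor_right sum_twist_left bxor_eq_zeroVec_iff)

/-! ### Vector bookkeeping for the blocks `y₁ ‖ (t·w)` -/

/-- `0 ‖ 0 = 0`. [folklore] -/
theorem acm_append_zeroVec (m n : ℕ) :
    Fin.append (zeroVec : Fin m → Bool) (zeroVec : Fin n → Bool) = zeroVec := by
  funext v
  induction v using Fin.addCases with
  | left i => rw [Fin.append_left]; rfl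
  | right j => rw [Fin.append_right]; rfl

/-- `t·w ⊕ t'·w = (t ⊕ t')·w`. [folklore] -/
theorem acm_sel_bxor {n : ℕ} (w : Fin n → Bool) (t t' : Bool) :
    bxor (if t then w else zeroVec) (if t' then w else zeroVec) = if (t ^^ t') then w else zeroVec := by
  cases t <;> cases t' <;> simp

/-- The embedding `(y₁, t) ↦ y₁ ‖ (t·w)` is injective when `w ≠ 0`. [folklore] -/
theorem acm_emb_injective {m n : ℕ} {w : Fin n → Bool} (hw : w ≠ zeroVec) :
    Function.Injective (fun p : (Fin m → Bool) × Bool => Fin.append p.1 (if p.2 then w else zeroVec)) := by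
  rintro ⟨y₁, t⟩ ⟨y₁', t'⟩ hpq
  dsimp only at hpq
  have h1 : y₁ = y₁' := by
    funext i
    have := congrFun hpq (Fin.castAdd n i)
    simpa only [Fin.append_left] using this
  have h2 : (if t then w else zeroVec) = (if t' then w else zeroVec) := by
    funext j
    have := congrFun hpq (Fin.natAdd m j)
    simpa only [Fin.append_right] using this
  have ht : t = t' := by
    cases t <;> cases t' <;> simp at h2 <;> first | rfl | exact absurd h2 hw | exact absurd h2.symm hw
  rw [h1, ht]

/-- `(-1)^{(x ⊕ y)·z} = (-1)^{x·z} (-1)^{y·z}`. [cite: Simon1994, §3.1] -/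
theorem acm_twist_bxor_left {n : ℕ} (x y z : Fin n → Bool) : twist (bxor x y) z = twist x z * twist y z :=
  Simon.twist_xor_left x y z

/-! ### Periodicity and the vanishing of second differences (in sign form) -/

/-- A `w`-periodic `φ` is invariant under the shift by `t·w`. [folklore] -/
theorem acm_phi_shift {a : ℕ} {φ : (Fin (a + 2) → Bool) → (Fin a → Bool)} {w : Fin (a + 2) → Bool}
    (hper : ∀ y, φ (bxor y w) = φ y) (t : Bool) (y₂ : Fin (a + 2) → Bool) :
    φ (bxor y₂ (if t then w else zeroVec)) = φ y₂ := by
  cases t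
  · simp
  · simpa using hper y₂

/-- The four `h`-signs along a second difference in directions `t·w`, `t'·w` multiply to `1`. [folklore] -/
theorem acm_h_prod {a : ℕ} (h : (Fin (a + 2) → Bool) → Bool) (w y₂ : Fin (a + 2) → Bool) (t t' : Bool) :
    signOf (h y₂) * signOf (h (bxor y₂ (if t then w else zeroVec))) *
      signOf (h (bxor y₂ (if t' then w else zeroVec))) *
      signOf (h (bxor y₂ (bxor (if t then w else zeroVec) (if t' then w else zeroVec)))) = 1 := by
  cases t <;> cases t' <;> simp <;> cases h y₂ <;> cases h (bxor y₂ w) <;> norm_num [signOf]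

/-- Abstract form of the sign computation: `(A s₀)(A B s₁)(A C s₂)(A B C s₃) = 1` for signs. [folklore] -/
theorem acm_prod_four {A B C s₀ s₁ s₂ s₃ X₀ X₁ X₂ X₃ : ℝ} (h0 : X₀ = A * s₀) (h1 : X₁ = A * B * s₁)
    (h2 : X₂ = A * C * s₂) (h3 : X₃ = A * (B * C) * s₃) (hA : A * A = 1) (hB : B * B = 1) (hC : C * C = 1)
    (hs : s₀ * s₁ * s₂ * s₃ = 1) : X₀ * X₁ * X₂ * X₃ = 1 := by
  subst h0 h1 h2 h3
  calc A * s₀ * (A * B * s₁) * (A * C * s₂) * (A * (B * C) * s₃)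
      = (A * A) * (A * A) * (B * B) * (C * C) * (s₀ * s₁ * s₂ * s₃) := by ring
    _ = 1 := by rw [hA, hB, hC, hs]; ring

/-- **Second differences vanish in sign form.** For `g` in almost-MM sign form with `w`-periodic `φ`, the product
of the four signs `(−1)^{g}` over `y, y ⊕ u, y ⊕ v, y ⊕ u ⊕ v` with `u = u₁ ‖ t·w`, `v = v₁ ‖ t'·w` is `1`. -/
theorem acm_sign_prod {a : ℕ} {g : (Fin (a + (a + 2)) → Bool) → Bool} {φ : (Fin (a + 2) → Bool) → (Fin a → Bool)}
    {h : (Fin (a + 2) → Bool) → Bool}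
    (hg : ∀ (y₁ : Fin a → Bool) (y₂ : Fin (a + 2) → Bool),
      signOf (g (Fin.append y₁ y₂)) = twist y₁ (φ y₂) * signOf (h y₂))
    {w : Fin (a + 2) → Bool} (hper : ∀ y, φ (bxor y w) = φ y) (y₁ u₁ v₁ : Fin a → Bool)
    (y₂ : Fin (a + 2) → Bool) (t t' : Bool) :
    signOf (g (Fin.append y₁ y₂)) *
      signOf (g (Fin.append (bxor y₁ u₁) (bxor y₂ (if t then w else zeroVec)))) *
      signOf (g (Fin.append (bxor y₁ v₁) (bxor y₂ (if t' then w else zeroVec)))) *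
      signOf (g (Fin.append (bxor y₁ (bxor u₁ v₁))
        (bxor y₂ (bxor (if t then w else zeroVec) (if t' then w else zeroVec))))) = 1 := by
  have h1 : signOf (g (Fin.append (bxor y₁ u₁) (bxor y₂ (if t then w else zeroVec)))) =
      twist y₁ (φ y₂) * twist u₁ (φ y₂) * signOf (h (bxor y₂ (if t then w else zeroVec))) := by
    rw [hg, acm_phi_shift hper, acm_twist_bxor_left]
  have h2 : signOf (g (Fin.append (bxor y₁ v₁) (bxor y₂ (if t' then w else zeroVec)))) =
      twist y₁ (φ y₂) * twist v₁ (φ y₂) * signOf (h (bxor y₂ (if t' then w else zeroVec))) := by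
    rw [hg, acm_phi_shift hper, acm_twist_bxor_left]
  have h3 : signOf (g (Fin.append (bxor y₁ (bxor u₁ v₁))
      (bxor y₂ (bxor (if t then w else zeroVec) (if t' then w else zeroVec))))) =
      twist y₁ (φ y₂) * (twist u₁ (φ y₂) * twist v₁ (φ y₂)) *
        signOf (h (bxor y₂ (bxor (if t then w else zeroVec) (if t' then w else zeroVec)))) := by
    rw [hg, ← acq_bxor_assoc y₂, acm_phi_shift hper, acm_phi_shift hper, acm_twist_bxor_left, acm_twist_bxor_left,
      acq_bxor_assoc]
  exact acm_prod_four (hg y₁ y₂) h1 h2 h3 (Simon.twist_mul_self _ _) (Simon.twist_mul_self _ _)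
    (Simon.twist_mul_self _ _) (acm_h_prod h w y₂ t t')

/-! ### The M-subspace -/

/-- **A periodic `φ` yields an M-subspace** (helper stub of `stub_ammCeiling`): if
`(−1)^{g(y₁‖y₂)} = (−1)^{y₁·φ(y₂)}(−1)^{h(y₂)}` and `φ(y ⊕ w) = φ(y)` for a non-zero `w`, then
`V = {y₁ ‖ t·w}` contains `0`, is closed under `⊕`, has `|V|² = 2^{a+(a+2)}`, and all second differences of `g`
along `V` vanish (arXiv:2508.14265, Prop. 4.1). -/
theorem acz_msubspace_of_periodic : ∀ (a : ℕ) (g : (Fin (a + (a + 2)) → Bool) → Bool) (φ : (Fin (a + 2) → Bool) → (Fin a → Bool)) (h : (Fin (a + 2) → Bool) → Bool), (∀ (y₁ : Fin a → Bool) (y₂ : Fin (a + 2) → Bool), signOf (g (Fin.append y₁ y₂)) = twist y₁ (φ y₂) * signOf (h y₂)) → ∀ (w : Fin (a + 2) → Bool), w ≠ zeroVec → (∀ y, φ (bxor y w) = φ y) → ∃ V : Finset (Fin (a + (a + 2)) → Bool), zeroVec ∈ V ∧ (∀ x ∈ V, ∀ y ∈ V, bxor x y ∈ V) ∧ V.card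 * V.card = 2 ^ (a + (a + 2)) ∧ ∀ u ∈ V, ∀ v ∈ V, ∀ y, (g y ^^ g (bxor y u) ^^ g (bxor y v) ^^ g (bxor y (bxor u v))) = false := by
  intro a g φ h hg w hw hper
  refine ⟨(univ : Finset ((Fin a → Bool) × Bool)).image
    (fun p => Fin.append p.1 (if p.2 then w else zeroVec)), ?_, ?_, ?_, ?_⟩
  · -- `0 = 0 ‖ 0·w ∈ V`
    refine mem_image.2 ⟨(zeroVec, false), mem_univ _, ?_⟩
    dsimp only
    simpa using acm_append_zeroVec a (a + 2)
  · -- closed under `⊕`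
    intro x hx y hy
    obtain ⟨⟨x₁, t⟩, -, rfl⟩ := mem_image.1 hx
    obtain ⟨⟨y₁, t'⟩, -, rfl⟩ := mem_image.1 hy
    refine mem_image.2 ⟨(bxor x₁ y₁, (t ^^ t')), mem_univ _, ?_⟩
    dsimp only
    rw [fc_bxor_append, acm_sel_bxor]
  · -- `|V|² = (2^a · 2)² = 2^{a+(a+2)}`
    rw [card_image_of_injective _ (acm_emb_injective hw), card_univ, Fintype.card_prod, Fintype.card_fun,
      Fintype.card_bool, Fintype.card_fin]
    ring
  · -- second differences
    intro u hu v hv y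
    obtain ⟨⟨u₁, t⟩, -, rfl⟩ := mem_image.1 hu
    obtain ⟨⟨v₁, t'⟩, -, rfl⟩ := mem_image.1 hv
    obtain ⟨y₁, y₂, rfl⟩ : ∃ (y₁ : Fin a → Bool) (y₂ : Fin (a + 2) → Bool), y = Fin.append y₁ y₂ :=
      ⟨_, _, Fin.append_castAdd_natAdd.symm⟩
    dsimp only
    apply acq_signOf_inj
    have key := acm_sign_prod hg hper y₁ u₁ v₁ y₂ t t'
    rw [signOf_xor, signOf_xor, signOf_xor, fc_bxor_append, fc_bxor_append, fc_bxor_append, fc_bxor_append]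
    rw [show signOf false = 1 from rfl]
    linear_combination key

end Summit.QuantumAdvantage.QuantumAdvantage.Theorems.CubicForrelation.NearExactIsExact

end
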